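import Summits.CriticalPhenomena.SAWScalingLimit.Theorems.SAWLoopFugacityFlowAvoidanceLimitHarnackChainDefs
import Summits.CriticalPhenomena.SAWScalingLimit.Theorems.SAWLoopFugacityFlowAvoidanceLimitCrossDiffAdapter
import Summits.CriticalPhenomena.SAWScalingLimit.Theorems.SAWLoopFugacityFlowAvoidanceLimitChainBookkeeping
import Literature.Probability.LatticeModels.BoundaryHarnackContraction
import HarnessLib

/-!
# UBHP from lattice local connectivity and the per-scale exit-kernel cross-ratio bound
(line `symplectic-fermion-anchor`, crux `SAWLoopFugacityFlow.AvoidanceLimit`, stmt-CriticalPhenomena-10649; lead c4)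

`uniformBHP_of_localConnectivity_of_crossRatio`: the uniform boundary Harnack principle for the
EDGE-killed `Ω_δ`-walk at a marked point of a Dobrushin domain (`UniformBHP` of the line's skeleton,
verbatim the stub `stub_uniformBHP`, and the hypothesis of
`Theorems.AnchorExcursion.anchorExcursion_of_uniformBHP_of_greenConvergence` and of
`Literature…KozdronLawler2005_martinRatioBoundaryLimit_of_greenConvergence_of_uniformBHP`) follows from

* (T) lattice uniform local connectivity of Jordan domains at a boundary point (`hT`), and
* (CR) a cross-ratio bound, with a constant `C` depending on `(D, p, R)` but not on the scale `j` nor on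
  the mesh `δ`, for the exit kernels `exitKernel H (chainR σ_j a₀)` of the boundary Harnack chain
  (`Theorems/SAWLoopFugacityFlowAvoidanceLimitHarnackChainDefs.lean`) along radii `σ_j = σ₀ 2^{-j}`, between
  entrance points of `chainS σ_{j+1} a₀` and exit points of `chainS σ_j a₀ ∖ chainR σ_j a₀` (`hCR`) —
  Chelkak–Wan's Lemma 3.7 input for the edge-killed walk,

by Chelkak–Wan's iteration (`transitionHarmonic_crossDiff_iterate_exit`, the lattice adapter of
`BoundaryHarnackContraction.crossDiff_iterate`), the chain bookkeeping
(`chainS_subset_chainR_of_le`, `dist_lt_of_mem_chainS`, `mem_farCluster_of_walk`) and the conversion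
`BoundaryHarnackContraction.le_mul_of_abs_sub_le`. [cite: ChelkakWan2021, Corollary 3.8]
-/

noncomputable section

open scoped BigOperators Topology Classical
open Filter Finset
open Literature.Probability.RandomPlanarGeometry Literature.Probability.LatticeModels

namespace Summit.CriticalPhenomena.SAWScalingLimit.Theorems.AvoidanceLimit.Anchor

/-- A contraction factor `k ∈ [0,1)` reaches any prescribed smallness: there is `q` with
`k^q (2 + η) ≤ η` (`η > 0`). [folklore] -/
theorem exists_pow_mul_le {k η : ℝ} (hk1 : k < 1) (hη : 0 < η) :
    ∃ q : ℕ, k ^ q * (2 + η) ≤ η := by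
  obtain ⟨q, hq⟩ := exists_pow_lt_of_lt_one (show 0 < η / (2 + η) by positivity) hk1
  refine ⟨q, ?_⟩
  have h2 : (0 : ℝ) < 2 + η := by positivity
  have := (lt_div_iff₀ h2).1 hq
  linarith

/-- **UBHP from (T) and (CR).** See the module docstring. The conclusion is the statement `UniformBHP`
of the line's skeleton, unfolded. [cite: ChelkakWan2021, Corollary 3.8] -/
theorem uniformBHP_of_localConnectivity_of_crossRatio :
    (∀ (D : JordanDomain) (p : ℂ), p ∈ frontier D.carrier → ∀ ρ : ℝ, 0 < ρ → ∃ r : ℝ, 0 < r ∧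
      ∀ᶠ δ in 𝓝[>] (0 : ℝ), ∀ u v : Site 2, u ∈ meshDomain D.carrier δ → v ∈ meshDomain D.carrier δ →
        dist (meshPoint δ u) p < r → dist (meshPoint δ v) p < r →
        ∃ w : (discreteDomainGraph D.carrier δ).Walk u v,
          ∀ z ∈ w.support, z ∈ meshDomain D.carrier δ ∧ dist (meshPoint δ z) p < ρ) →
    (∀ (D : JordanDomain) (p : ℂ), p ∈ frontier D.carrier → ∀ R : ℝ, 0 < R →
      ∃ C : ℝ, 1 ≤ C ∧ ∃ σ₀ : ℝ, 0 < σ₀ ∧ σ₀ < R ∧ ∀ j : ℕ, ∀ᶠ δ in 𝓝[>] (0 : ℝ),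
        ∀ a₀ u v x y : Site 2, a₀ ∈ meshDomainFinset D.carrier δ →
          dist (meshPoint δ a₀) p < σ₀ / 2 ^ (j + 2) →
          u ∈ chainS (discreteDomainGraph D.carrier δ) (meshDomainFinset D.carrier δ) δ p R (σ₀ / 2 ^ (j + 1)) a₀ →
          v ∈ chainS (discreteDomainGraph D.carrier δ) (meshDomainFinset D.carrier δ) δ p R (σ₀ / 2 ^ (j + 1)) a₀ →
          x ∈ chainS (discreteDomainGraph D.carrier δ) (meshDomainFinset D.carrier δ) δ p R (σ₀ / 2 ^ j) a₀ →
          y ∈ chainS (discreteDomainGraph D.carrier δ) (meshDomainFinset D.carrier δ) δ p R (σ₀ / 2 ^ j) a₀ →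
          x ∉ chainR (discreteDomainGraph D.carrier δ) (meshDomainFinset D.carrier δ) δ p R (σ₀ / 2 ^ j) a₀ →
          y ∉ chainR (discreteDomainGraph D.carrier δ) (meshDomainFinset D.carrier δ) δ p R (σ₀ / 2 ^ j) a₀ →
          exitKernel (discreteDomainGraph D.carrier δ)
              (chainR (discreteDomainGraph D.carrier δ) (meshDomainFinset D.carrier δ) δ p R (σ₀ / 2 ^ j) a₀) u x *
            exitKernel (discreteDomainGraph D.carrier δ)
              (chainR (discreteDomainGraph D.carrier δ) (meshDomainFinset D.carrier δ) δ p R (σ₀ / 2 ^ j) a₀) v y ≤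
          C * (exitKernel (discreteDomainGraph D.carrier δ)
              (chainR (discreteDomainGraph D.carrier δ) (meshDomainFinset D.carrier δ) δ p R (σ₀ / 2 ^ j) a₀) v x *
            exitKernel (discreteDomainGraph D.carrier δ)
              (chainR (discreteDomainGraph D.carrier δ) (meshDomainFinset D.carrier δ) δ p R (σ₀ / 2 ^ j) a₀) u y)) →
    ∀ (D : DobrushinDomain) (i : Fin 2) (R : ℝ), 0 < R → ∀ η : ℝ, 0 < η → ∃ r : ℝ, 0 < r ∧
      ∀ᶠ δ in 𝓝[>] (0 : ℝ), ∀ h₁ h₂ : ↥(meshDomainFinset D.carrier δ) → ℝ,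
        (∀ x, 0 ≤ h₁ x) → (∀ x, 0 ≤ h₂ x) →
        (∀ x : ↥(meshDomainFinset D.carrier δ), dist (meshPoint δ x) (D.pt i) < R →
          Matrix.mulVec ((4 : ℝ)⁻¹ • adjMat (discreteDomainGraph D.carrier δ)
            (meshDomainFinset D.carrier δ)) h₁ x = h₁ x) →
        (∀ x : ↥(meshDomainFinset D.carrier δ), dist (meshPoint δ x) (D.pt i) < R →
          Matrix.mulVec ((4 : ℝ)⁻¹ • adjMat (discreteDomainGraph D.carrier δ)
            (meshDomainFinset D.carrier δ)) h₂ x = h₂ x) →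
        ∀ z z' : ↥(meshDomainFinset D.carrier δ), dist (meshPoint δ z) (D.pt i) < r →
          dist (meshPoint δ z') (D.pt i) < r → h₁ z * h₂ z' ≤ (1 + η) * (h₁ z' * h₂ z) := by
  intro hT hCR D i R hR η hη
  set p : ℂ := D.pt i with hp
  have hpfr : p ∈ frontier D.carrier := D.pt_mem_frontier i
  -- the cross-ratio constant and the top scale
  obtain ⟨C, hC, σ₀, hσ₀, hσ₀R, hCRj⟩ := hCR D.toJordanDomain p hpfr R hR
  -- the contraction factor and the number of scales
  set k : ℝ := (C - 1) / (C + 1) with hk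
  have hk1 : k < 1 := by rw [hk, div_lt_one (by linarith)]; linarith
  obtain ⟨q, hq⟩ := exists_pow_mul_le hk1 hη
  -- the radii `σ j = σ₀ / 2^j` and the final radius from (T) at `ρ = σ q`
  set σ : ℕ → ℝ := fun j => σ₀ / 2 ^ j with hσ
  have hσpos : ∀ j, 0 < σ j := fun j => by positivity
  obtain ⟨r₀, hr₀, hTev⟩ := hT D.toJordanDomain p hpfr (σ q) (hσpos q)
  refine ⟨min r₀ (σ₀ / 2 ^ (q + 2)), lt_min hr₀ (by positivity), ?_⟩
  -- eventually in `δ`: (T) at `ρ = σ q`, (CR) at every `j < q`, and `0 < δ ≤ σ₀ / 2^q`, `δ ≤ R - σ₀`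
  have hCRall := (eventually_all_finset (Finset.range q)).2 fun j _ => hCRj j
  have hsmall : ∀ᶠ δ in 𝓝[>] (0 : ℝ), δ ∈ Set.Ioo (0 : ℝ) (min (σ₀ / 2 ^ q) (R - σ₀)) :=
    Ioo_mem_nhdsGT (lt_min (by positivity) (by linarith))
  filter_upwards [hTev, hCRall, hsmall] with δ hTδ hCRδ hδs
  obtain ⟨hδ0, hδlt⟩ := hδs
  have hδq : δ ≤ σ₀ / 2 ^ q := hδlt.le.trans (min_le_left _ _)
  have hδR : σ₀ + δ ≤ R := by linarith [hδlt.le.trans (min_le_right _ _)]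
  intro h₁ h₂ hpos₁ hpos₂ hharm₁ hharm₂ z z' hz hz'
  -- notation-free: `Λ = meshDomainFinset D δ`, `H = discreteDomainGraph D δ`, anchor `a₀ = z`
  have hHzd : discreteDomainGraph D.carrier δ ≤ zdGraph 2 :=
    (discreteDomainGraph_le_meshGraph D.carrier δ).trans (meshGraph_le_zdGraph D.carrier δ)
  have hΛcoe : ((meshDomainFinset D.carrier δ : Finset (Site 2)) : Set (Site 2)) = meshDomain D.carrier δ :=
    coe_meshDomainFinset D.isBounded hδ0
  have hmemΛ : ∀ {v : Site 2}, v ∈ meshDomain D.carrier δ ↔ v ∈ meshDomainFinset D.carrier δ := fun {v} => by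
    rw [← Finset.mem_coe, hΛcoe]
  have hzr : dist (meshPoint δ (z : Site 2)) p < σ₀ / 2 ^ (q + 2) := lt_of_lt_of_le hz (min_le_right _ _)
  -- geometry of the radii
  have hσsucc : ∀ j, j < q → σ (j + 1) + δ ≤ σ j := by
    intro j hj
    have h2 : σ (j + 1) = σ j / 2 := by
      simp only [hσ, pow_succ]; field_simp
    have hle : σ₀ / 2 ^ q ≤ σ j / 2 := by
      simp only [hσ]
      rw [div_div, ← pow_succ]
      exact div_le_div_of_nonneg_left hσ₀.le (by positivity)
        (pow_le_pow_right₀ (by norm_num) (Nat.succ_le_of_lt hj))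
    linarith
  have hσq2 : σ₀ / 2 ^ (q + 2) ≤ σ q := by
    simp only [hσ]
    exact div_le_div_of_nonneg_left hσ₀.le (by positivity) (pow_le_pow_right₀ (by norm_num) (by omega))
  have hσle : ∀ j, σ j ≤ σ₀ := fun j =>
    div_le_self hσ₀.le (one_le_pow₀ (by norm_num))
  -- membership of `z`, `z'` in `S q`
  have hzΛ : (z : Site 2) ∈ meshDomainFinset D.carrier δ := z.2
  have hz'Λ : (z' : Site 2) ∈ meshDomainFinset D.carrier δ := z'.2
  have hzS : (z : Site 2) ∈ chainS (discreteDomainGraph D.carrier δ) (meshDomainFinset D.carrier δ) δ p R (σ q)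
      (z : Site 2) := by
    refine farCluster_subset_chainS (z : Site 2) (mem_farCluster_of_walk
      (SimpleGraph.Walk.nil : (discreteDomainGraph D.carrier δ).Walk (z : Site 2) (z : Site 2)) ?_)
    intro w hw
    rw [SimpleGraph.Walk.support_nil, List.mem_singleton] at hw
    rw [hw]
    exact ⟨hzΛ, hzr.trans_le hσq2⟩
  have hz'S : (z' : Site 2) ∈ chainS (discreteDomainGraph D.carrier δ) (meshDomainFinset D.carrier δ) δ p R (σ q)
      (z : Site 2) := by
    obtain ⟨w, hw⟩ := hTδ (z : Site 2) (z' : Site 2) (hmemΛ.2 hzΛ) (hmemΛ.2 hz'Λ)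
      (lt_of_lt_of_le hz (min_le_left _ _)) (lt_of_lt_of_le hz' (min_le_left _ _))
    refine farCluster_subset_chainS (z : Site 2) (mem_farCluster_of_walk w fun x hx => ?_)
    exact ⟨hmemΛ.1 (hw x hx).1, (hw x hx).2⟩
  -- Chelkak–Wan's iteration
  have key := transitionHarmonic_crossDiff_iterate_exit (discreteDomainGraph D.carrier δ) hHzd
    (meshDomainFinset D.carrier δ)
    (fun j => chainS (discreteDomainGraph D.carrier δ) (meshDomainFinset D.carrier δ) δ p R (σ j) (z : Site 2))
    (fun j => chainR (discreteDomainGraph D.carrier δ) (meshDomainFinset D.carrier δ) δ p R (σ j) (z : Site 2)) q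
    chainS_subset (fun j hj => chainS_subset_chainR_of_le hHzd hδ0.le (hσsucc j hj) (z : Site 2))
    (fun j _ w => mem_chainR_iff) h₁ h₂ hpos₁ hpos₂
    (fun x hx => hharm₁ x (dist_lt_of_mem_chainS hHzd hδ0.le (by linarith [hσle 0]) hx))
    (fun x hx => hharm₂ x (dist_lt_of_mem_chainS hHzd hδ0.le (by linarith [hσle 0]) hx))
    C hC ?_ z z' hzS hz'S
  · -- conversion to the division-free form
    exact BoundaryHarnackContraction.le_mul_of_abs_sub_le
      (mul_nonneg (hpos₁ z') (hpos₂ z)) hη.le hq key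
  · -- the kernel cross-ratio bound at every scale `j < q`
    intro j hj u v x y hu hv hx hy hxR hyR
    have hja : dist (meshPoint δ (z : Site 2)) p < σ₀ / 2 ^ (j + 2) := by
      refine hzr.trans_le (div_le_div_of_nonneg_left hσ₀.le (by positivity) ?_)
      exact pow_le_pow_right₀ (by norm_num) (by omega)
    have h := hCRδ j (Finset.mem_range.2 hj) (z : Site 2) u v x y hzΛ hja hu hv hx hy hxR hyR
    simpa only [exitKernel_eq] using h

end Summit.CriticalPhenomena.SAWScalingLimit.Theorems.AvoidanceLimit.Anchor

end
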